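import Summits.Parity.GeneralizedHardyLittlewood.Theorems.LeeYangFibresAbsoluteUpgradeUniformResidualDefs
import Summits.Parity.GeneralizedHardyLittlewood.Theorems.LeeYangFibresAbsoluteUpgradeUniformGrowth
import Summits.Parity.GeneralizedHardyLittlewood.Theorems.LeeYangFibresAbsoluteUpgradeUniformAmplificationAux
import Summits.Parity.GeneralizedHardyLittlewood.Theorems.LeeYangFibresRelativeDimOneAmplificationAux
import Summits.Parity.GeneralizedHardyLittlewood.Theorems.LeeYangFibresRelativeDimOneSingularMeanGlueAux
import Summits.Parity.GeneralizedHardyLittlewood.Theorems.LeeYangFibresRelativeDimOneLocalAverage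
import Summits.Parity.GeneralizedHardyLittlewood.Theorems.LeeYangFibresRelativeDimOneTightness
import Summits.Parity.GeneralizedHardyLittlewood.Theorems.LeeYangFibresRelativeDimOne
import Summits.Parity.GeneralizedHardyLittlewood.Theorems.LeeYangFibresAbsoluteUpgradeSingularProductLogLog
import Summits.Parity.GeneralizedHardyLittlewood.Theorems.LeeYangFibresAbsoluteUpgradeSlices
import Summits.Parity.GeneralizedHardyLittlewood.Theorems.LeeYangFibresCellParityLawSingularRatio
import Literature.NumberTheory.Sieve.LinearEquationsInPrimesCrudeBounds
import HarnessLib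

/-!
# Route `LeeYangFibres`, crux `AbsoluteUpgrade` (stmt-Parity-14116), line `Sketch` (uniform amplification):
# the transfer from the SHARPENED residual (stub F′ `stub_amplificationFromTranslates`)

`AmplificationFromTranslates := UniformSingularMean → CollisionFormFacts → TranslateUniformRelativeDimOne → DimOne`
(vocabulary `Theorems/LeeYangFibresAbsoluteUpgradeUniformResidualDefs.lean`).  The landed transfer `stub_amplification`
(`Theorems/LeeYangFibresAbsoluteUpgradeUniformAmplification.lean`, p143322) consumes relative Hardy–Littlewood uniform in
the number of forms (`UniformRelativeDimOne`) at exactly two kinds of instances: the given `t`-system `Ψ` on `K` (low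
singular mass) and its non-degenerate translate-constellations `Ψ^{(H)}` on `K_H`, `H ∈ [-2N,2N]^m` (high mass).  Both are
instances of `TranslateUniformRelativeDimOne` (the first one with `m = 0`: the trivial translate-constellation
`Ψ^{(∅)}` on `K_∅ = K` has the same von Mangoldt sum, archimedean factor and singular product as `Ψ` on `K` —
`vonMangoldtSum_translateFamily_zeroShift`, `archFactor_translateFamily_zeroShift`,
`singularProduct_translateFamily_zeroShift`), so the same proof runs from the weaker hypothesis: parameter schedule,
low/high mass split at `5N`, `uniform_high_mass_amplify` with the gain `1/(m+1)`, `m = ⌊(log log N)^{t-1}⌋`, verbatim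
from the landed file.  Consequence for the skeleton: the residual stub of the line becomes
`stub_translateUniformRelativeDimOne : TranslateUniformRelativeDimOne` — the weakest statement the mechanism is known to need.

References: B. Green, T. Tao, Ann. of Math. 171 (2010), Conj. 1.2 / Conj. 1.4 and Lemma 1.3 [GreenTao2010];
P. X. Gallagher, Mathematika 23 (1976), §2 [Gallagher1976]; T. Tao, V. Vu, *Additive Combinatorics*, §2.
-/

noncomputable section

open scoped BigOperators Classical Topology
open Finset Filter MeasureTheory Literature.NumberTheory.Sieve
open Summit.Parity.GeneralizedHardyLittlewood.Cruxes.RelativeDimOne.TranslateAmplification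

namespace Summit.Parity.GeneralizedHardyLittlewood.Cruxes.AbsoluteUpgrade.UniformAmplification

variable {t : ℕ}

/-! ### The trivial translate-constellation `m = 0` is the system itself -/

/-- The empty shift `H = ∅ ∈ ℤ^0`. [folklore] -/
def zeroShift : Fin 0 → ℤ := fun j => j.elim0

/-- `∅ ∈ [-2N, 2N]^0`. [folklore] -/
theorem zeroShift_mem_shiftBox (N : ℕ) : zeroShift ∈ shiftBox 0 N := by
  rw [shiftBox, Fintype.mem_piFinset]
  exact fun j => j.elim0

/-- `[-2N, 2N]^0 = {∅}`. [folklore] -/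
theorem shiftBox_zero (N : ℕ) : shiftBox 0 N = {zeroShift} := by
  refine Finset.eq_singleton_iff_unique_mem.mpr ⟨zeroShift_mem_shiftBox N, fun H _ => ?_⟩
  funext j
  exact j.elim0

/-- `K_∅ = K`. [folklore] -/
theorem meetTranslates_zeroShift (K : Set (Fin 1 → ℝ)) : meetTranslates K zeroShift = K := by
  have hzero : ∀ j : Fin (0 + 1), shiftVec zeroShift j = 0 := fun j => by
    rw [Fin.fin_one_eq_zero j]
    exact shiftVec_zero _
  ext x
  simp only [meetTranslates, Set.mem_setOf_eq, hzero, Int.cast_zero, add_zero]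
  exact ⟨fun h => h 0, fun h _ => h⟩

/-- `S(Ψ^{(∅)}, K_∅) = S(Ψ, K)` for `K ⊆ [-N, N]` (the complete-sum identity with `m = 0`). [folklore] -/
theorem vonMangoldtSum_translateFamily_zeroShift (Ψ : Fin t → AffLinForm 1) {K : Set (Fin 1 → ℝ)} {N : ℕ}
    (hKN : K ⊆ realBox 1 N) :
    vonMangoldtSum (translateFamily Ψ zeroShift) (meetTranslates K zeroShift) N = vonMangoldtSum Ψ K N := by
  have h := completeSum 0 t N Ψ K hKN
  rwa [shiftBox_zero, Finset.sum_singleton, pow_succ, pow_zero, one_mul] at h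

/-- `β_∞(Ψ^{(∅)}, K_∅) = β_∞(Ψ, K)`. [folklore] -/
theorem archFactor_translateFamily_zeroShift (Ψ : Fin t → AffLinForm 1) (K : Set (Fin 1 → ℝ)) :
    archFactor (translateFamily Ψ zeroShift) (meetTranslates K zeroShift) = archFactor Ψ K := by
  rw [archFactor_translateFamily, meetTranslates_zeroShift, archFactor_eq_volume_posBody]

/-- `β_q(Ψ^{(∅)}) = β_q(Ψ)` for every modulus `q`. [folklore] -/
theorem localFactor_translateFamily_zeroShift (Ψ : Fin t → AffLinForm 1) (q : ℕ) :
    localFactor (translateFamily Ψ zeroShift) q = localFactor Ψ q := by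
  rw [localFactor_translateFamily, localFactor_fin_one]
  congr 1
  refine Finset.sum_congr rfl fun c _ => ?_
  rw [Fin.prod_univ_zero, mul_one]

/-- `𝔖(Ψ^{(∅)}) = 𝔖(Ψ)`. [folklore] -/
theorem singularProduct_translateFamily_zeroShift (Ψ : Fin t → AffLinForm 1) :
    singularProduct (translateFamily Ψ zeroShift) = singularProduct Ψ := by
  have h : singularProductPartial (translateFamily Ψ zeroShift) = singularProductPartial Ψ := by
    funext x
    unfold singularProductPartial
    exact Finset.prod_congr rfl fun q _ => localFactor_translateFamily_zeroShift Ψ q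
  unfold singularProduct
  rw [h]

/-! ### The transfer from the sharpened residual -/

/-- **THE TRANSFER FROM THE SHARPENED RESIDUAL** (registered stub `stub_amplificationFromTranslates` of line `Sketch`,
stub F′): m-uniform Gallagher averaging + the explicit degenerate count + relative Dickson–Hardy–Littlewood for the
translate-constellations of `t`-systems only, uniform in the number of translates, give ABSOLUTE
Dickson–Hardy–Littlewood `DimOne` — the proof of `stub_amplification` verbatim, its hypothesis now met only where it
is used. [cite: GreenTao2010, Conj. 1.2 and Conj. 1.4] -/
theorem stub_amplificationFromTranslates : AmplificationFromTranslates := by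
  unfold AmplificationFromTranslates
  intro hUSM hCF hS t L ht ε hε
  -- `e = min ε 1`
  obtain ⟨e, he⟩ : ∃ e : ℝ, e = min ε 1 := ⟨_, rfl⟩
  have he0 : 0 < e := by rw [he]; exact lt_min hε one_pos
  have he1 : e ≤ 1 := by rw [he]; exact min_le_right _ _
  have heε : e ≤ ε := by rw [he]; exact min_le_left _ _
  -- the singular-mass constant (S1) and `ε₁`
  obtain ⟨C, hC0, N₁, hS1⟩ := Theorems.AbsoluteUpgrade.stub_singularProduct_le_loglog_pow t L ht
  obtain ⟨ε₁, hε₁⟩ : ∃ ε₁ : ℝ, ε₁ = e / (100 * (C + 1)) := ⟨_, rfl⟩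
  have hε₁0 : 0 < ε₁ := by rw [hε₁]; positivity
  have hε₁8 : ε₁ ≤ 1 / 8 := by
    rw [hε₁, div_le_iff₀ (by positivity)]
    linarith
  have h6 : 6 * ε₁ ≤ e := by
    rw [hε₁, mul_div_assoc', div_le_iff₀ (by positivity)]
    nlinarith [mul_nonneg he0.le hC0.le]
  have h16 : 16 * ε₁ * C ≤ e := by
    have h1 : 16 * ε₁ * C = e * (16 * C / (100 * (C + 1))) := by rw [hε₁]; ring
    have h2 : 16 * C / (100 * (C + 1)) ≤ 1 := by
      rw [div_le_one (by positivity)]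
      linarith
    rw [h1]
    exact (mul_le_mul_of_nonneg_left h2 he0.le).trans (le_of_eq (mul_one e))
  -- the hypotheses, instantiated once (before the scale)
  obtain ⟨N₂, hN₂⟩ := hS t L 1 ht ε₁ hε₁0
  obtain ⟨N₃, hN₃⟩ := hS t L t ht ε₁ hε₁0
  obtain ⟨N₄, hN₄⟩ := hUSM t L t ht ε₁ hε₁0
  -- the scale: `log log N ≥ 2t`, `N ≥ 1`, and the uniform junk inequality
  have hL₁ : (1 : ℝ) ≤ ((max L 1 : ℕ) : ℝ) := by exact_mod_cast le_max_right L 1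
  have hLL₁ : (L : ℝ) ≤ ((max L 1 : ℕ) : ℝ) := by exact_mod_cast le_max_left L 1
  obtain ⟨N₅, hN₅⟩ := Filter.eventually_atTop.mp ((eventually_le_loglog (2 * (t : ℝ))).and
    ((eventually_ge_atTop 1).and (eventually_degenerate_junk_le ht hL₁ hε₁0)))
  refine ⟨N₁ + N₂ + N₃ + N₄ + N₅, fun N hN Ψ hΨ hL K hK hKN => ?_⟩
  have hNN₁ : N₁ ≤ N := by omega
  have hNN₂ : N₂ ≤ N := by omega
  have hNN₃ : N₃ ≤ N := by omega
  have hNN₄ : N₄ ≤ N := by omega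
  obtain ⟨hℓ, hN1, hJ⟩ := hN₅ N (by omega)
  have hN0 : (0 : ℝ) ≤ N := Nat.cast_nonneg N
  have hN1r : (1 : ℝ) ≤ N := by exact_mod_cast hN1
  have ht1r : (1 : ℝ) ≤ t := by exact_mod_cast ht
  -- the number of translates
  obtain ⟨m, hm1, hmℓ, hT⟩ := exists_translates ht hℓ
  have hm0 : (0 : ℝ) < (m : ℝ) + 1 := by positivity
  -- `S`, `M = β_∞ 𝔖` and the singular mass
  have hS0 : 0 ≤ vonMangoldtSum Ψ K N :=
    Theorems.LeeYangFibresRelativeDimOne.vonMangoldtSum_nonneg Ψ K N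
  have hV0 : 0 ≤ archFactor Ψ K := archFactor_nonneg' Ψ K
  have hV2 : archFactor Ψ K ≤ 2 * (N : ℝ) := Theorems.AbsoluteUpgrade.archFactor_le_two_mul Ψ hKN
  have h𝔖0 : 0 ≤ singularProduct Ψ :=
    CellParityLaw.SectionAnnihilator.SingularRatio.singularProduct_nonneg hΨ
  have h𝔖C : singularProduct Ψ ≤ C * Real.log (Real.log N) ^ (t - 1) := hS1 N hNN₁ Ψ hΨ hL
  have hM0 : 0 ≤ archFactor Ψ K * singularProduct Ψ := mul_nonneg hV0 h𝔖0
  have hMle : archFactor Ψ K * singularProduct Ψ ≤ 2 * (N : ℝ) * (C * ((m : ℝ) + 1)) :=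
    calc archFactor Ψ K * singularProduct Ψ ≤ 2 * (N : ℝ) * (C * Real.log (Real.log N) ^ (t - 1)) :=
          mul_le_mul hV2 h𝔖C h𝔖0 (by positivity)
      _ ≤ 2 * (N : ℝ) * (C * ((m : ℝ) + 1)) :=
          mul_le_mul_of_nonneg_left (mul_le_mul_of_nonneg_left hmℓ.le hC0.le) (by positivity)
  have heN : e * (N : ℝ) ≤ ε * N := mul_le_mul_of_nonneg_right heε hN0
  rcases lt_or_ge (archFactor Ψ K * singularProduct Ψ) (5 * N) with hlow | hhigh
  · -- LOW MASS: relative Hardy–Littlewood for the trivial translate-constellation `m = 0` (which is `Ψ` on `K`)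
    have hT0 : (((0 + 1) * t : ℕ) : ℝ) ≤ Real.log (Real.log N) ^ 1 := by
      rw [pow_one]; push_cast; linarith
    have h := hN₂ N hNN₂ 0 hT0 Ψ hΨ hL K hK hKN zeroShift (zeroShift_mem_shiftBox N)
      (isNondegenerateSystem_translateFamily_fin_zero hΨ zeroShift)
    rw [vonMangoldtSum_translateFamily_zeroShift Ψ hKN, archFactor_translateFamily_zeroShift,
      singularProduct_translateFamily_zeroShift] at h
    calc |vonMangoldtSum Ψ K N - archFactor Ψ K * singularProduct Ψ|
        ≤ ε₁ * (archFactor Ψ K * singularProduct Ψ + N) := h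
      _ ≤ ε₁ * (6 * N) := mul_le_mul_of_nonneg_left (by linarith) hε₁0.le
      _ = 6 * ε₁ * N := by ring
      _ ≤ e * N := mul_le_mul_of_nonneg_right h6 hN0
      _ ≤ ε * N := heN
  · -- HIGH MASS: the tensor-power trick with `m + 1` translates
    have hL'1 : (1 : ℝ) ≤ (3 * (m : ℝ) + 1) * ((max L 1 : ℕ) : ℝ) := by
      have hm0' : (0 : ℝ) ≤ m := Nat.cast_nonneg m
      nlinarith
    have hsize' : ∀ H ∈ shiftBox m N,
        affLinSize (translateFamily Ψ H) N ≤ (3 * m + 1) * ((max L 1 : ℕ) : ℝ) :=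
      fun H hH => affLinSize_translateFamily_le hN1 (hL.trans hLL₁) hH
    have hB0 : 0 ≤ (2 * (N : ℝ) + 1) *
        Real.log (2 * ((3 * (m : ℝ) + 1) * ((max L 1 : ℕ) : ℝ)) * N) ^ ((m + 1) * t) := by
      refine mul_nonneg (by positivity) (pow_nonneg (Real.log_nonneg ?_) _)
      nlinarith
    have key := uniform_high_mass_amplify (shiftBox m N)
      (fun H => IsNondegenerateSystem (translateFamily Ψ H))
      (fun H => vonMangoldtSum (translateFamily Ψ H) (meetTranslates K H) N)
      (fun H => archFactor (translateFamily Ψ H) (meetTranslates K H) *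
        singularProduct (translateFamily Ψ H))
      m hε₁0.le hε₁8 hS0 hM0 hhigh (completeSum m t N Ψ K hKN) (hN₄ N hNN₄ m hT Ψ hΨ hL K hK hKN)
      (fun H hH hnd => hN₃ N hNN₃ m hT Ψ hΨ hL K hK hKN H hH hnd)
      (fun H hH _ => vonMangoldtSum_le_card_mul hN1 hL'1 (hsize' H hH) (meetTranslates K H))
      hB0
      (fun H _ => Theorems.LeeYangFibresRelativeDimOne.vonMangoldtSum_nonneg _ _ _)
      (card_shiftBox_real_le m hN1) (hCF.1 m t N Ψ hΨ) (hJ m hT)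
    calc |vonMangoldtSum Ψ K N - archFactor Ψ K * singularProduct Ψ|
        ≤ 8 * ε₁ / ((m : ℝ) + 1) * (archFactor Ψ K * singularProduct Ψ) := key
      _ ≤ 8 * ε₁ / ((m : ℝ) + 1) * (2 * (N : ℝ) * (C * ((m : ℝ) + 1))) :=
          mul_le_mul_of_nonneg_left hMle (by positivity)
      _ = 16 * ε₁ * C * N := by
          rw [div_mul_eq_mul_div, div_eq_iff hm0.ne']
          ring
      _ ≤ e * N := mul_le_mul_of_nonneg_right h16 hN0
      _ ≤ ε * N := heN


/-- **Door (b′), curried**: `UniformSingularMean → CollisionFormFacts → TranslateUniformRelativeDimOne → DimOne` with the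
hypotheses named. [cite: GreenTao2010, Conj. 1.2 and Conj. 1.4] -/
theorem dimOne_of_uniformSingularMean_of_translateUniform (hUSM : UniformSingularMean)
    (hCF : CollisionFormFacts) (hT : TranslateUniformRelativeDimOne) : Theses.LeeYangFibres.DimOne :=
  stub_amplificationFromTranslates hUSM hCF hT

end Summit.Parity.GeneralizedHardyLittlewood.Cruxes.AbsoluteUpgrade.UniformAmplification

end
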